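import Literature.Probability.RandomPlanarGeometry.ObliqueRBMWedgeCanonical
import Literature.Probability.Process.BrownianRunningMaxBounds
import HarnessLib

/-!
# The canonical reflected Brownian motion spends little time near the sides

Layer of the proof of
`Literature.Probability.RandomPlanarGeometry.LawlerSchrammWerner2001_orbm_uniformHitting`
(`ObliqueRBMWedge.lean`): quantitative "no stickiness" of the canonical obliquely reflected
Brownian motion `canORBM` (`ObliqueRBMWedgeCanonical.lean`) at the two sides of the wedge. Its
quadrant coordinates are one-dimensional reflected Brownian motions,
`y(Z_s) = W_s − min_{[0,s]} W` with `W = y(β) = (2/√3) B²` and `x(Z_s) = V_s − min_{[0,s]} V` with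
`V = x(β) = B¹ − B²/√3 = (2/√3) · ((√3/2) B¹ − (1/2) B²)` a multiple of a standard Brownian
motion (`Process.isBrownianReal_pairComb`), so the small-ball bound
`Process.measure_forall_sub_lt_le_of_isPreBrownianReal` gives

* `measure_quadY_canORBM_lt_le`, `measure_quadX_canORBM_lt_le` —
  **`P(y(Z_s) < m) ≤ 2 √(m/√s)` and `P(x(Z_s) < m) ≤ 2 √(m/√s)`** for all `s, m > 0`:
  the probability of being within (coordinate) distance `m` of a side at time `s` is
  `O(m^{1/2} s^{-1/4})`. This is the occupation estimate that controls the boundary terms in the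
  one-step (Dynkin) analysis of `canORBM`.

Also: `exists_skorokhodBdry_eq` (the supremum in the boundary term is attained) and the
descriptions `quadY_canORBM_lt_iff`, `quadX_canORBM_lt_iff` of the events.

## References

* W. Werner, LNM 1840 (2004), Ch. 5 §5.1; J. Dubédat, Ann. IHP 40 (2004), §2 ("the walk spends a
  negligible time on the boundary"). [WernerStFlour2004] [Dubedat2004]
-/

noncomputable section

open MeasureTheory ProbabilityTheory Complex Set Filter
open scoped NNReal Real Topology ENNReal

namespace Literature.Probability.RandomPlanarGeometry

open Literature.Probability.Process

/-- The supremum in the boundary term of a continuous path is attained. [folklore] -/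
theorem exists_skorokhodBdry_eq {b : ℝ≥0 → ℝ} (hb : Continuous b) (t : ℝ≥0) :
    ∃ r ≤ t, skorokhodBdry b t = max 0 (-b r) := by
  have hc : ContinuousOn (fun r ↦ max 0 (-b r)) (Iic t) := (by fun_prop : Continuous _).continuousOn
  obtain ⟨r₀, hr₀, hmax⟩ := (isCompact_Iic_nnreal t).exists_isMaxOn nonempty_Iic hc
  refine ⟨r₀, hr₀, le_antisymm ?_ (le_skorokhodBdry hb hr₀)⟩
  rw [skorokhodBdry_le_iff hb]
  exact fun r hr ↦ hmax hr

/-- The event `{y(Z_s) < m}` is `{∀ r ≤ s, y(β_s) − y(β_r) < m}` (recall `y(β₀) = 0`).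
[folklore] -/
theorem quadY_canORBM_lt_iff {s : ℝ≥0} {ω : WienerPair} {m : ℝ} :
    quadY (canORBM s ω) < m ↔ ∀ r ≤ s, quadY (pairBM s ω) - quadY (pairBM r ω) < m := by
  have hc := continuous_quadY_pairBM ω
  rw [quadY_canORBM]
  unfold canL₁
  constructor
  · intro h r hr
    have := le_skorokhodBdry hc hr
    have h2 : -quadY (pairBM r ω) ≤ max 0 (-quadY (pairBM r ω)) := le_max_right _ _
    linarith
  · intro h
    obtain ⟨r₀, hr₀, heq⟩ := exists_skorokhodBdry_eq hc s
    rw [heq]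
    rcases le_total 0 (-quadY (pairBM r₀ ω)) with h0 | h0
    · rw [max_eq_right h0]; linarith [h r₀ hr₀]
    · rw [max_eq_left h0]
      have := h 0 bot_le
      have h00 : quadY (0 : ℂ) = 0 := by simp [quadY]
      rw [pairBM_zero, h00, sub_zero] at this
      linarith

/-- The event `{x(Z_s) < m}` is `{∀ r ≤ s, x(β_s) − x(β_r) < m}`. [folklore] -/
theorem quadX_canORBM_lt_iff {s : ℝ≥0} {ω : WienerPair} {m : ℝ} :
    quadX (canORBM s ω) < m ↔ ∀ r ≤ s, quadX (pairBM s ω) - quadX (pairBM r ω) < m := by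
  have hc := continuous_quadX_pairBM ω
  rw [quadX_canORBM]
  unfold canL₂
  constructor
  · intro h r hr
    have := le_skorokhodBdry hc hr
    have h2 : -quadX (pairBM r ω) ≤ max 0 (-quadX (pairBM r ω)) := le_max_right _ _
    linarith
  · intro h
    obtain ⟨r₀, hr₀, heq⟩ := exists_skorokhodBdry_eq hc s
    rw [heq]
    rcases le_total 0 (-quadX (pairBM r₀ ω)) with h0 | h0
    · rw [max_eq_right h0]; linarith [h r₀ hr₀]
    · rw [max_eq_left h0]
      have := h 0 bot_le
      have h00 : quadX (0 : ℂ) = 0 := by simp [quadX]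
      rw [pairBM_zero, h00, sub_zero] at this
      linarith

/-- `x(β) = (2/√3) · ((√3/2) B¹ − (1/2) B²)`. [folklore] -/
theorem quadX_pairBM_eq (t : ℝ≥0) (ω : WienerPair) :
    quadX (pairBM t ω) = 2 / Real.sqrt 3 * pairComb (Real.sqrt 3 / 2) (-(1 / 2)) t ω := by
  have h3 : Real.sqrt 3 ≠ 0 := by positivity
  have h3' : Real.sqrt 3 * Real.sqrt 3 = 3 := Real.mul_self_sqrt (by norm_num)
  simp only [quadX, pairBM_re, pairBM_im, pairComb]
  field_simp
  nlinarith [h3']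

/-- `y(β) = (2/√3) B²`. [folklore] -/
theorem quadY_pairBM_eq (t : ℝ≥0) (ω : WienerPair) :
    quadY (pairBM t ω) = 2 / Real.sqrt 3 * brownian t ω.2 := by
  rw [quadY_pairBM]; ring

/-- The elementary inequality behind the trivial case: for `√s < (√3/2) m`,
`1 ≤ 2 √(m/√s)`. [folklore] -/
theorem one_le_two_mul_sqrt {s m : ℝ} (hs : 0 < s) (h : Real.sqrt s < Real.sqrt 3 / 2 * m) :
    (1 : ℝ) ≤ 2 * Real.sqrt (m / Real.sqrt s) := by
  have hsq : 0 < Real.sqrt s := Real.sqrt_pos.2 hs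
  have h3 : Real.sqrt 3 < 2 := by
    rw [show (2 : ℝ) = Real.sqrt 4 by rw [show (4:ℝ) = 2 ^ 2 by norm_num, Real.sqrt_sq (by norm_num)]]
    exact Real.sqrt_lt_sqrt (by norm_num) (by norm_num)
  have hm : Real.sqrt s < m := by nlinarith [Real.sqrt_nonneg 3]
  have h1 : 1 ≤ m / Real.sqrt s := by rw [le_div_iff₀ hsq]; linarith
  have h2 : 1 ≤ Real.sqrt (m / Real.sqrt s) := by
    rw [show (1:ℝ) = Real.sqrt 1 by simp]
    exact Real.sqrt_le_sqrt h1
  linarith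

/-- **The reflected process is rarely near the first side**: for all `s > 0`, `m > 0`,
`P(y(Z_s) < m) ≤ 2 √(m/√s)`. [folklore] -/
theorem measure_quadY_canORBM_lt_le {s : ℝ≥0} (hs : 0 < s) {m : ℝ} (hm : 0 < m) :
    wienerPair {ω | quadY (canORBM s ω) < m} ≤ ENNReal.ofReal (2 * Real.sqrt (m / Real.sqrt s)) := by
  haveI := isProbabilityMeasure_preWienerMeasure'
  have hs' : (0 : ℝ) < s := by exact_mod_cast hs
  have h3 : (0 : ℝ) < Real.sqrt 3 := by positivity
  set m' : ℝ := Real.sqrt 3 / 2 * m with hm'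
  have hm'0 : 0 < m' := by positivity
  by_cases hcase : m' ≤ Real.sqrt s
  · -- `{y(Z_s) < m} = {∀ r ≤ s, B²_s − B²_r < m'}`
    have hset : {ω : WienerPair | quadY (canORBM s ω) < m} =
        {ω | ∀ r ≤ s, brownian s ω.2 - brownian r ω.2 < m'} := by
      ext ω
      simp only [mem_setOf_eq, quadY_canORBM_lt_iff, quadY_pairBM_eq]
      refine forall₂_congr fun r _ ↦ ?_
      rw [← mul_sub, hm']
      constructor
      · intro h
        have := mul_lt_mul_of_pos_left h (by positivity : (0:ℝ) < Real.sqrt 3 / 2)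
        have e : Real.sqrt 3 / 2 * (2 / Real.sqrt 3 * (brownian s ω.2 - brownian r ω.2)) =
            brownian s ω.2 - brownian r ω.2 := by field_simp
        linarith [e]
      · intro h
        have := mul_lt_mul_of_pos_left h (by positivity : (0:ℝ) < 2 / Real.sqrt 3)
        have e : 2 / Real.sqrt 3 * (Real.sqrt 3 / 2 * m) = m := by field_simp
        linarith [e]
    rw [hset]
    refine (measure_forall_sub_lt_le_of_isPreBrownianReal isPreBrownianReal_brownian_snd
      (fun t ↦ (measurable_brownian t).comp measurable_snd) (fun ω ↦ continuous_brownian ω.2)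
      hs hm'0 hcase).trans (ENNReal.ofReal_le_ofReal ?_)
    gcongr
    rw [hm']
    have : Real.sqrt 3 / 2 ≤ 1 := by
      have : Real.sqrt 3 < 2 := by
        rw [show (2 : ℝ) = Real.sqrt 4 by rw [show (4:ℝ) = 2 ^ 2 by norm_num, Real.sqrt_sq (by norm_num)]]
        exact Real.sqrt_lt_sqrt (by norm_num) (by norm_num)
      linarith
    nlinarith
  · rw [not_le] at hcase
    exact (prob_le_one).trans (by
      rw [← ENNReal.ofReal_one]
      exact ENNReal.ofReal_le_ofReal (one_le_two_mul_sqrt hs' hcase))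

/-- **The reflected process is rarely near the second side**: for all `s > 0`, `m > 0`,
`P(x(Z_s) < m) ≤ 2 √(m/√s)`. [folklore] -/
theorem measure_quadX_canORBM_lt_le {s : ℝ≥0} (hs : 0 < s) {m : ℝ} (hm : 0 < m) :
    wienerPair {ω | quadX (canORBM s ω) < m} ≤ ENNReal.ofReal (2 * Real.sqrt (m / Real.sqrt s)) := by
  haveI := isProbabilityMeasure_preWienerMeasure'
  have hs' : (0 : ℝ) < s := by exact_mod_cast hs
  have h3 : (0 : ℝ) < Real.sqrt 3 := by positivity
  set m' : ℝ := Real.sqrt 3 / 2 * m with hm'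
  have hm'0 : 0 < m' := by positivity
  have hV : IsBrownianReal (pairComb (Real.sqrt 3 / 2) (-(1 / 2))) wienerPair :=
    isBrownianReal_pairComb (by
      rw [div_pow, Real.sq_sqrt (by norm_num)]
      norm_num)
  by_cases hcase : m' ≤ Real.sqrt s
  · have hset : {ω : WienerPair | quadX (canORBM s ω) < m} =
        {ω | ∀ r ≤ s, pairComb (Real.sqrt 3 / 2) (-(1 / 2)) s ω -
          pairComb (Real.sqrt 3 / 2) (-(1 / 2)) r ω < m'} := by
      ext ω
      simp only [mem_setOf_eq, quadX_canORBM_lt_iff, quadX_pairBM_eq]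
      refine forall₂_congr fun r _ ↦ ?_
      rw [← mul_sub, hm']
      set d := pairComb (Real.sqrt 3 / 2) (-(1 / 2)) s ω - pairComb (Real.sqrt 3 / 2) (-(1 / 2)) r ω
      constructor
      · intro h
        have := mul_lt_mul_of_pos_left h (by positivity : (0:ℝ) < Real.sqrt 3 / 2)
        have e : Real.sqrt 3 / 2 * (2 / Real.sqrt 3 * d) = d := by field_simp
        linarith [e]
      · intro h
        have := mul_lt_mul_of_pos_left h (by positivity : (0:ℝ) < 2 / Real.sqrt 3)
        have e : 2 / Real.sqrt 3 * (Real.sqrt 3 / 2 * m) = m := by field_simp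
        linarith [e]
    rw [hset]
    refine (measure_forall_sub_lt_le_of_isPreBrownianReal hV.toIsPreBrownianReal
      (measurable_pairComb _ _) (continuous_pairComb _ _) hs hm'0 hcase).trans
      (ENNReal.ofReal_le_ofReal ?_)
    gcongr
    rw [hm']
    have : Real.sqrt 3 / 2 ≤ 1 := by
      have : Real.sqrt 3 < 2 := by
        rw [show (2 : ℝ) = Real.sqrt 4 by rw [show (4:ℝ) = 2 ^ 2 by norm_num, Real.sqrt_sq (by norm_num)]]
        exact Real.sqrt_lt_sqrt (by norm_num) (by norm_num)
      linarith
    nlinarith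
  · rw [not_le] at hcase
    exact (prob_le_one).trans (by
      rw [← ENNReal.ofReal_one]
      exact ENNReal.ofReal_le_ofReal (one_le_two_mul_sqrt hs' hcase))

end Literature.Probability.RandomPlanarGeometry
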